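import Summits.QuantumFields.YangMills.Theorems.BalabanUVNodesN15KingModelExactCorrelationLength

/-!
# BalabanUVNodes ∕ N15 — THE KING-MODEL RUNG (PART Ϸ-k): REFLECTION POSITIVITY OF THE CONTINUUM TWO-POINT FUNCTION `S₂^{ℝ}` UNDER THE BLOCK REFLECTION
# `θ_ν : z ↦ (z_⊥, −z_ν − 1)` ON THE HALF-LATTICE `{z_ν ≥ 0}`: `Σ_{i,j} c_i c_j S₂^{ℝ}(θ_ν z_i − z_j) ≥ 0` (Track A, DAG node N15 = NE2; FAN-OUT v1.1 §N15 s3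
# «KING-MODEL RUNG»; an OS-type positivity read off part Ϸ-j's Laplace representation; count-neutral)

HONEST FRAMING.  Count-neutral (cell `pub-ymgap`, seat `pub-ymgap-dag-n15-e` g34; `--supports stmt-QuantumFields-27366 --as helper` = K3⁸
`SpineGivenEndpointR13SepCoPHV`).  King's `A = 0`, `g = 0` model ([King1986] C. King, Commun. Math. Phys. **102** (1986) 649–677): `S₂^{ℝ}(z)`, `z ∈ ℤ^{d+1}`, is
the infinite-volume two-point function of the UNIT-BLOCK AVERAGES of the continuum free field of mass `m` ((4.5) p.670, (4.36) p.674); the block labelled `z` is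
`z + [0,1)^{d+1}`, so the Euclidean reflection `x_ν ↦ −x_ν` maps the block `z` to the block `θ_ν z := (z_⊥, −z_ν − 1)`.  Part Ϸ-j's Laplace representation
(`|z_ν| ≥ 1`) reads, for `z_ν, w_ν ≥ 0` (so `(θ_ν z − w)_ν = −(z_ν + w_ν + 1)`),
`S₂^{ℝ}(θ_ν z − w) = (2π)^{−(d+1)}∫P(q)·cos(q·z_⊥ − q·w_⊥)·2π(cosh M_q − 1)M_q⁻³·e^{−M_q(z_ν + w_ν + 1)}dq`, and since
`Σ_{i,j}c_i c_j cos(φ_i − φ_j)e^{−M(a_i + a_j + 1)} = e^{−M}[(Σ_i c_i e^{−Ma_i}cos φ_i)² + (Σ_i c_i e^{−Ma_i}sin φ_i)²] ≥ 0`, the quadratic form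
`Σ_{i,j∈s}c_i c_j S₂^{ℝ}(θ_ν z_i − z_j)` is `≥ 0` for every finite family of half-lattice sites `z_i` (`(z_i)_ν ≥ 0`) and real coefficients `c_i` — REFLECTION
POSITIVITY of the covariance of King's `K = ∞` block field with respect to block reflections in every lattice direction.  (For a centred Gaussian field this
kernel positivity is the input of the standard RP of the Gaussian law; only the kernel statement is proved here.)  NOT a node discharge (N15 is booked through
n15-a's knit, untouched here); nothing Bałaban ∕ continuum-Yang–Mills ∕ `ℝ⁴` ∕ Clay; an OS-axiom-flavoured fact about the FREE block field only.  0 `sorry`, 0 def;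
standard axioms.

WHAT THIS FILE PROVES (kernel).  §1 `reflect_sub_apply_same`, `reflect_sub_apply_succAbove`, `abs_cast_reflect_sub`; ★★ **`kingS2Inf_reflect_sub_eq`** (the Laplace
representation of `S₂^{ℝ}(θ_ν z − w)` on the half-lattice).  §2 ★ `sum_sum_mul_cos_sub_mul_exp_eq` (the sum of squares), `sum_sum_mul_cos_sub_mul_exp_nonneg`;
`continuous_reflectKernel`, `integrable_reflectKernel`.  §3 ★★★ **`kingS2Inf_reflection_positive`** (`0 ≤ Σ_{i,j∈s}c_i c_j S₂^{ℝ}(θ_ν z_i − z_j)`).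

HONEST SCOPE.  King's free model, `K = ∞`, infinite volume; block reflections `θ_ν`, half-lattice `{z_ν ≥ 0}`; kernel (two-point) positivity only.  N15 untouched;
counts unmoved.  Locators (use): [King1986] (4.5) p.670, (4.36) p.674, Thm 3.3 (3.6) p.655, Thm 2.1 (2.22)–(2.23) p.654.
-/

noncomputable section

open scoped BigOperators Topology
open Filter MeasureTheory Set

namespace Summit.QuantumFields.YangMills.BalabanUVNodes.N15KingModelRung.OptimalDecay

variable {d : ℕ}

/-! ## §1 The block reflection and the Laplace representation of `S₂^{ℝ}(θ_ν z − w)` -/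

/-- `(θ_ν z − w)_ν = −z_ν − 1 − w_ν`. [folklore] -/
theorem reflect_sub_apply_same (ν : Fin (d + 1)) (z w : Fin (d + 1) → ℤ) : (Function.update z ν (-z ν - 1) - w) ν = -z ν - 1 - w ν := by
  simp

/-- `(θ_ν z − w)_{ν↑k} = z_{ν↑k} − w_{ν↑k}` (the reflection only touches the `ν`-th coordinate). [folklore] -/
theorem reflect_sub_apply_succAbove (ν : Fin (d + 1)) (z w : Fin (d + 1) → ℤ) (k : Fin d) :
    (Function.update z ν (-z ν - 1) - w) (ν.succAbove k) = z (ν.succAbove k) - w (ν.succAbove k) := by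
  simp

/-- On the half-lattice: `|(θ_ν z − w)_ν| = |z_ν + w_ν + 1|` (`= z_ν + w_ν + 1 ≥ 1` when `z_ν, w_ν ≥ 0`). [folklore] -/
theorem abs_cast_reflect_sub (ν : Fin (d + 1)) (z w : Fin (d + 1) → ℤ) :
    |(((Function.update z ν (-z ν - 1) - w) ν : ℤ) : ℝ)| = |(z ν : ℝ) + w ν + 1| := by
  rw [reflect_sub_apply_same]
  push_cast
  rw [show -(z ν : ℝ) - 1 - w ν = -((z ν : ℝ) + w ν + 1) by ring, abs_neg]

/-- ★★ **THE LAPLACE REPRESENTATION ON THE HALF-LATTICE**: for `z_ν, w_ν ≥ 0`,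
`S₂^{ℝ}(θ_ν z − w) = (2π)^{−(d+1)}∫cos(q·z_⊥ − q·w_⊥)·P(q)·2π(cosh M_q − 1)M_q⁻³·e^{−M_q|z_ν + w_ν + 1|}dq` (part Ϸ-j with `|(θ_ν z − w)_ν| = z_ν + w_ν + 1 ≥ 1`).
[cite: King1986, (4.5) p.670, (4.36) p.674, Thm 3.3 (3.6) p.655] -/
theorem kingS2Inf_reflect_sub_eq {m2 : ℝ} (hm : 0 < m2) (ν : Fin (d + 1)) {z w : Fin (d + 1) → ℤ} (hz : 0 ≤ z ν) (hw : 0 ≤ w ν) :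
    kingS2Inf m2 (Function.update z ν (-z ν - 1) - w)
      = ((2 * Real.pi) ^ (d + 1))⁻¹ * ∫ q : Fin d → ℝ,
          Real.cos ((∑ k, q k * z (ν.succAbove k)) - ∑ k, q k * w (ν.succAbove k))
            * ((∏ j, Real.sinc (q j / 2) ^ 2) * (2 * Real.pi * (Real.cosh (Real.sqrt ((∑ j, q j ^ 2) + m2)) - 1) / Real.sqrt ((∑ j, q j ^ 2) + m2) ^ 3
                * Real.exp (-(Real.sqrt ((∑ j, q j ^ 2) + m2) * |(z ν : ℝ) + w ν + 1|)))) := by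
  have hz' : (0 : ℝ) ≤ z ν := by exact_mod_cast hz
  have hw' : (0 : ℝ) ≤ w ν := by exact_mod_cast hw
  have h1 : 1 ≤ |(((Function.update z ν (-z ν - 1) - w) ν : ℤ) : ℝ)| := by
    rw [abs_cast_reflect_sub, abs_of_nonneg (by linarith)]
    linarith
  rw [kingS2Inf_eq_integral_exp hm _ ν h1, abs_cast_reflect_sub]
  congr 1
  refine integral_congr_ae (Eventually.of_forall fun q => ?_)
  simp only [reflect_sub_apply_succAbove, Int.cast_sub, mul_sub, Finset.sum_sub_distrib]
  ring

/-! ## §2 The sum of squares, and the kernel's integrability -/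

/-- ★ **The sum of squares**: `Σ_{i,j}c_i c_j cos(φ_i − φ_j)·P·W·e^{−M|a_i + a_j + 1|} = P·W·e^{−M}·[(Σ_i c_i e^{−Ma_i}cos φ_i)² + (Σ_i c_i e^{−Ma_i}sin φ_i)²]` for `a_i ≥ 0`
on `s`. [folklore] -/
theorem sum_sum_mul_cos_sub_mul_exp_eq {ι : Type*} (s : Finset ι) (c a φ : ι → ℝ) (P W M : ℝ) (ha : ∀ i ∈ s, 0 ≤ a i) :
    ∑ i ∈ s, ∑ j ∈ s, c i * c j * (Real.cos (φ i - φ j) * (P * (W * Real.exp (-(M * |a i + a j + 1|)))))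
      = P * W * Real.exp (-M) * ((∑ i ∈ s, c i * Real.exp (-(M * a i)) * Real.cos (φ i)) ^ 2 + (∑ i ∈ s, c i * Real.exp (-(M * a i)) * Real.sin (φ i)) ^ 2) := by
  rw [sq, sq, Finset.sum_mul_sum, Finset.sum_mul_sum, ← Finset.sum_add_distrib, Finset.mul_sum]
  refine Finset.sum_congr rfl fun i hi => ?_
  rw [← Finset.sum_add_distrib, Finset.mul_sum]
  refine Finset.sum_congr rfl fun j hj => ?_
  have he : Real.exp (-(M * |a i + a j + 1|)) = Real.exp (-M) * Real.exp (-(M * a i)) * Real.exp (-(M * a j)) := by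
    rw [abs_of_nonneg (by linarith [ha i hi, ha j hj]), ← Real.exp_add, ← Real.exp_add]
    congr 1
    ring
  rw [Real.cos_sub, he]
  ring

/-- Hence `≥ 0` when `P, W ≥ 0`. [folklore] -/
theorem sum_sum_mul_cos_sub_mul_exp_nonneg {ι : Type*} (s : Finset ι) (c a φ : ι → ℝ) {P W : ℝ} (M : ℝ) (hP : 0 ≤ P) (hW : 0 ≤ W) (ha : ∀ i ∈ s, 0 ≤ a i) :
    0 ≤ ∑ i ∈ s, ∑ j ∈ s, c i * c j * (Real.cos (φ i - φ j) * (P * (W * Real.exp (-(M * |a i + a j + 1|))))) := by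
  rw [sum_sum_mul_cos_sub_mul_exp_eq s c a φ P W M ha]
  positivity

/-- The reflected kernel `q ↦ cos(q·z_⊥ − q·w_⊥)·(axial weight at t = z_ν + w_ν + 1)` is continuous (`m² > 0`). [folklore] -/
theorem continuous_reflectKernel {m2 : ℝ} (hm : 0 < m2) (ν : Fin (d + 1)) (z w : Fin (d + 1) → ℤ) :
    Continuous fun q : Fin d → ℝ => Real.cos ((∑ k, q k * z (ν.succAbove k)) - ∑ k, q k * w (ν.succAbove k))
      * ((∏ j, Real.sinc (q j / 2) ^ 2) * (2 * Real.pi * (Real.cosh (Real.sqrt ((∑ j, q j ^ 2) + m2)) - 1) / Real.sqrt ((∑ j, q j ^ 2) + m2) ^ 3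
          * Real.exp (-(Real.sqrt ((∑ j, q j ^ 2) + m2) * |(z ν : ℝ) + w ν + 1|)))) :=
  Continuous.mul (by fun_prop) (continuous_axisWeight hm _)

/-- The reflected kernel is integrable over `ℝ^d` for `z_ν, w_ν ≥ 0` (`|cos| ≤ 1` times part Ϸ-j's integrable axial weight at `t = z_ν + w_ν + 1 ≥ 1`). [folklore] -/
theorem integrable_reflectKernel {m2 : ℝ} (hm : 0 < m2) (ν : Fin (d + 1)) {z w : Fin (d + 1) → ℤ} (hz : 0 ≤ z ν) (hw : 0 ≤ w ν) :
    Integrable fun q : Fin d → ℝ => Real.cos ((∑ k, q k * z (ν.succAbove k)) - ∑ k, q k * w (ν.succAbove k))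
      * ((∏ j, Real.sinc (q j / 2) ^ 2) * (2 * Real.pi * (Real.cosh (Real.sqrt ((∑ j, q j ^ 2) + m2)) - 1) / Real.sqrt ((∑ j, q j ^ 2) + m2) ^ 3
          * Real.exp (-(Real.sqrt ((∑ j, q j ^ 2) + m2) * |(z ν : ℝ) + w ν + 1|)))) := by
  have hz' : (0 : ℝ) ≤ z ν := by exact_mod_cast hz
  have hw' : (0 : ℝ) ≤ w ν := by exact_mod_cast hw
  have ht : 1 ≤ |(z ν : ℝ) + w ν + 1| := by
    rw [abs_of_nonneg (by linarith)]
    linarith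
  refine (integrable_axisWeight hm ht).mono' (continuous_reflectKernel hm ν z w).aestronglyMeasurable (Eventually.of_forall fun q => ?_)
  rw [Real.norm_eq_abs, abs_mul, abs_of_nonneg (axisWeight_nonneg m2 _ q)]
  calc _ ≤ 1 * _ := mul_le_mul_of_nonneg_right (Real.abs_cos_le_one _) (axisWeight_nonneg m2 _ q)
    _ = _ := one_mul _

/-! ## §3 Reflection positivity -/

/-- ★★★ **REFLECTION POSITIVITY OF `S₂^{ℝ}` UNDER BLOCK REFLECTIONS**: for `m² > 0`, every direction `ν`, every finite family of half-lattice sites `z_i ∈ ℤ^{d+1}`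
(`(z_i)_ν ≥ 0`, `i ∈ s`) and real coefficients `c_i`: `0 ≤ Σ_{i∈s}Σ_{j∈s}c_i c_j S₂^{ℝ}(θ_ν z_i − z_j)`, `θ_ν z = (z_⊥, −z_ν − 1)` — the covariance of King's `K = ∞`
block field is reflection positive with respect to the block reflection in every lattice direction (Laplace representation + sum of squares).
[cite: King1986, (4.5) p.670, (4.36) p.674, Thm 2.1 (2.22)–(2.23) p.654, Thm 3.3 (3.6) p.655] -/
theorem kingS2Inf_reflection_positive {m2 : ℝ} (hm : 0 < m2) (ν : Fin (d + 1)) {ι : Type*} (s : Finset ι) (c : ι → ℝ) (z : ι → Fin (d + 1) → ℤ)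
    (hz : ∀ i ∈ s, 0 ≤ z i ν) :
    0 ≤ ∑ i ∈ s, ∑ j ∈ s, c i * c j * kingS2Inf m2 (Function.update (z i) ν (-(z i ν) - 1) - z j) := by
  -- the reflected kernels
  set G : ι → ι → (Fin d → ℝ) → ℝ := fun i j q => Real.cos ((∑ k, q k * z i (ν.succAbove k)) - ∑ k, q k * z j (ν.succAbove k))
      * ((∏ l, Real.sinc (q l / 2) ^ 2) * (2 * Real.pi * (Real.cosh (Real.sqrt ((∑ l, q l ^ 2) + m2)) - 1) / Real.sqrt ((∑ l, q l ^ 2) + m2) ^ 3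
          * Real.exp (-(Real.sqrt ((∑ l, q l ^ 2) + m2) * |(z i ν : ℝ) + z j ν + 1|)))) with hG
  have hGint : ∀ i ∈ s, ∀ j ∈ s, Integrable (G i j) := fun i hi j hj => integrable_reflectKernel hm ν (hz i hi) (hz j hj)
  have hterm : ∀ i ∈ s, ∀ j ∈ s, c i * c j * kingS2Inf m2 (Function.update (z i) ν (-(z i ν) - 1) - z j)
      = ((2 * Real.pi) ^ (d + 1))⁻¹ * ∫ q, c i * c j * G i j q := by
    intro i hi j hj
    rw [kingS2Inf_reflect_sub_eq hm ν (hz i hi) (hz j hj), integral_const_mul]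
    ring
  rw [Finset.sum_congr rfl fun i hi => Finset.sum_congr rfl fun j hj => hterm i hi j hj]
  -- exchange the finite sums with the integral
  have hswap : ∑ i ∈ s, ∑ j ∈ s, ((2 * Real.pi) ^ (d + 1))⁻¹ * ∫ q, c i * c j * G i j q
      = ((2 * Real.pi) ^ (d + 1))⁻¹ * ∫ q, ∑ i ∈ s, ∑ j ∈ s, c i * c j * G i j q := by
    rw [integral_finsetSum _ (fun i hi => integrable_finsetSum _ fun j hj => (hGint i hi j hj).const_mul _), Finset.mul_sum]
    refine Finset.sum_congr rfl fun i hi => ?_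
    rw [integral_finsetSum _ (fun j hj => (hGint i hi j hj).const_mul _), Finset.mul_sum]
  rw [hswap]
  refine mul_nonneg (by positivity) (integral_nonneg fun q => ?_)
  -- pointwise: the sum of squares
  have hzr : ∀ i ∈ s, (0 : ℝ) ≤ (z i ν : ℝ) := fun i hi => by exact_mod_cast hz i hi
  have hc1 : 0 ≤ Real.cosh (Real.sqrt ((∑ l, q l ^ 2) + m2)) - 1 := by linarith [Real.one_le_cosh (Real.sqrt ((∑ l, q l ^ 2) + m2))]
  have h := sum_sum_mul_cos_sub_mul_exp_nonneg s c (fun i => (z i ν : ℝ)) (fun i => ∑ k, q k * z i (ν.succAbove k))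
    (P := ∏ l, Real.sinc (q l / 2) ^ 2) (W := 2 * Real.pi * (Real.cosh (Real.sqrt ((∑ l, q l ^ 2) + m2)) - 1) / Real.sqrt ((∑ l, q l ^ 2) + m2) ^ 3)
    (Real.sqrt ((∑ l, q l ^ 2) + m2)) (Finset.prod_nonneg fun l _ => sq_nonneg _) (by positivity) hzr
  simp only [hG]
  exact h

end Summit.QuantumFields.YangMills.BalabanUVNodes.N15KingModelRung.OptimalDecay
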